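import Literature.AlgebraicGeometry.HodgeTheory.WeightOneHodgeStructuresOfTori
import HarnessLib

/-!
# Route `SecondaryPeriods` — crux `RiemannWeightOne` (stmt-HodgeConjecture-16406), line `birth`: stub `stub_torusCohomologyBasis`

The registered stub `stub_torusCohomologyBasis` of the line skeleton
`Summits/HodgeConjecture/HodgeConjecture/Cruxes/RiemannWeightOne/Lines/birth.lean`, proved
unconditionally: the Literature theorem
`Literature.AlgebraicGeometry.HodgeTheory.weightOne_torusCohomology_of_isAnalytification`
(**the weight-one Hodge structure of the algebraised torus `(V_ℝ, J)/⊕ ℤ(1 ⊗ bₐ)` maps ONTO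
`hodgeStructureOfCx J hJ`**) for an ARBITRARY `ℚ`-basis `b : Module.Basis κ ℚ V` of `V` in place of
the hard-wired `Module.finBasis ℚ V`.

**Statement.** Let `J` be a complex structure on `V_ℝ = ℝ ⊗_ℚ V`, `E` a rational alternating form
with the Riemann relations for `J` (`E_ℝ(Ja, Jc) = E_ℝ(a, c)`, `E_ℝ(a, Ja) > 0` for `a ≠ 0`), `b` a
`ℚ`-basis of `V` indexed by a finite type `κ`, and suppose the polarised torus
`T = (V_ℝ, J)/⊕ ℤ(1 ⊗ bₐ) = ComplexTorus (CxModule.periodIso J hJ' hn (b.baseChange ℝ))` is the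
analytification `φ : T → X(ℂ)` of a smooth projective `X/ℂ` of dimension `n`. Then for a
Hodge-symmetric Hodge model `B` of `X` the weight-one Hodge structure on `H¹(X(ℂ); ℚ)` maps by a
SURJECTIVE morphism of Hodge structures onto `hodgeStructureOfCx J hJ`.

**Proof** (verbatim the Literature proof, with `b` for `Module.finBasis ℚ V`). The morphism is
`φ_E⁻¹ ∘ u` with `u : H¹(X(ℂ); ℚ) ≅ ℚ^κ` the lattice coordinates of
`exists_hodgeModel_weightOne_of_complexTorus` and `φ_E : V ≅ ℚ^κ`, `x ↦ (E(x, bₐ))ₐ` (bijective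
because `E_ℝ(a, Ja) > 0` makes `E` non-degenerate and `dim V = #κ`); it maps `F¹` into `cxF1 J`
because a `ℂ`-linear functional `ℓ` on `(V_ℝ, J)` restricted to the lattice is
`(E_ℝ(w, ·) + iE_ℝ(Jw, ·))|_Λ = (φ_E ⊗ ℂ)(w + iJw)` for the `E_ℝ`-dual `w` of `Re ℓ`
(`exists_mkCx_eq_sum_tmul_basis`); `F⁰ ↦ ⊤` and `Fᵖ = 0` for `p ≥ 2`. Voisin, *Hodge Theory and
Complex Algebraic Geometry I*, §7.2.2 (PDF p. 142): "`H^{1,0}(T) = V^*`. Thus we have shown that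
the Hodge structure on `H¹(T)` is dual to that of" the given one; Lange–Birkenhake Lemma 1.1.17,
Thm. 1.1.21, and §2.4 for the identification `V ≅ V^∨` by the polarisation.

Auxiliary (§A, linear algebra of a Riemann form in the basis `b`):
`injective_of_riemannForm_basis`/`bijective_of_riemannForm_basis` (`φ_E`),
`baseChange_pi_ofRealT_basis`, `baseChange_pi_mkCx_basis` (`(φ_E ⊗ ℂ)(w + iw')` in lattice
coordinates), `exists_mkCx_eq_sum_tmul_basis`.

## References

* [VoisinHodgeI2002] C. Voisin, Hodge Theory and Complex Algebraic Geometry I, §7.2.2 (PDF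
  pp. 141–143).
* [LangeBirkenhake1992] H. Lange, Ch. Birkenhake, Complex Abelian Varieties, §1.1 Lemma 1.1.17,
  Thm. 1.1.21; §2.1 Thm. 2.1.18; §2.4.
-/

noncomputable section

-- every declaration of this problem lives in `Summit.HodgeConjecture.HodgeConjecture.…`
set_option linter.dupNamespace false

namespace Summit.HodgeConjecture.HodgeConjecture.Theorems.RiemannWeightOne

open scoped TensorProduct Manifold ContDiff LinearAlgebra.Projectivization
open CategoryTheory AlgebraicGeometry
open Literature.AlgebraicGeometry.Motives
open Literature.AlgebraicGeometry.Motives.HodgeStructure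
open Literature.AlgebraicGeometry.HodgeTheory (HodgeModel)
open Literature.Geometry.Kaehler (ComplexTorus CxModule IsAnalyticSet)
open Literature.NumberTheory.Transcendental (IsAnalytification IsProjAlgebraicSet projPoint)

/-! ### §A. Linear algebra of a Riemann form in a basis `b`: `φ_E : V ≅ ℚ^κ` -/

section RiemannFormDualityBasis

variable {V : Type} [AddCommGroup V] [Module ℚ V] {κ : Type} (b : Module.Basis κ ℚ V)
  (J : ℝ ⊗[ℚ] V →ₗ[ℝ] ℝ ⊗[ℚ] V) (E : LinearMap.BilinForm ℚ V) (ψ : V →ₗ[ℚ] (κ → ℚ))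

/-- **`φ_E : V → ℚ^κ`, `x ↦ (E(x, bₐ))ₐ`, is injective** for a Riemann form `E`: if
`E(x, bₐ) = 0` for all `a` then `E(x, ·) = 0`, so `E_ℝ(1 ⊗ x, ·) = 0`, contradicting
`E_ℝ(a, Ja) > 0` unless `x = 0`. [cite: LangeBirkenhake1992, §2.4] -/
theorem injective_of_riemannForm_basis (hpos : ∀ a, a ≠ 0 → 0 < E.baseChange ℝ a (J a))
    (hψ : ∀ x a, ψ x a = E x (b a)) : Function.Injective ψ := by
  rw [injective_iff_map_eq_zero]
  intro x hx
  have hE0 : E x = 0 := b.ext fun a => by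
    rw [LinearMap.zero_apply, ← hψ, hx, Pi.zero_apply]
  have hE0ℝ : ∀ c, E.baseChange ℝ ((1 : ℝ) ⊗ₜ[ℚ] x) c = 0 := by
    intro c
    induction c using TensorProduct.induction_on with
    | zero => simp
    | tmul r y => rw [LinearMap.BilinForm.baseChange_tmul, hE0, LinearMap.zero_apply, zero_smul]
    | add c c' hc hc' => rw [map_add, hc, hc', add_zero]
  by_contra hne
  have h1 : (1 : ℝ) ⊗ₜ[ℚ] x ≠ 0 := by
    intro h0
    apply hne
    rw [← b.repr.map_eq_zero_iff]
    ext a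
    have h2 := congrArg (fun w => (b.baseChange ℝ).repr w a) h0
    simp only [Module.Basis.baseChange_repr_tmul, map_zero, Finsupp.zero_apply,
      Rat.smul_one_eq_cast, Rat.cast_eq_zero] at h2
    rw [h2, Finsupp.zero_apply]
  exact (hpos _ h1).ne' (hE0ℝ _)

variable [Module.Finite ℚ V] [Fintype κ]

/-- Hence `φ_E : V ≅ ℚ^κ` is bijective (`dim_ℚ V = #κ`). [cite: LangeBirkenhake1992, §2.4] -/
theorem bijective_of_riemannForm_basis
    (hpos : ∀ a, a ≠ 0 → 0 < E.baseChange ℝ a (J a))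
    (hψ : ∀ x a, ψ x a = E x (b a)) : Function.Bijective ψ :=
  ⟨injective_of_riemannForm_basis b J E ψ hpos hψ,
    (LinearMap.injective_iff_surjective_of_finrank_eq_finrank
      (by rw [Module.finrank_fintype_fun_eq_card, Module.finrank_eq_card_basis b])).1
      (injective_of_riemannForm_basis b J E ψ hpos hψ)⟩

variable [DecidableEq κ]

omit [Module.Finite ℚ V] in
/-- `(φ_E ⊗ ℂ)(w) = Σₐ E_ℝ(w, 1 ⊗ bₐ) ⊗ eₐ` for real `w ∈ V_ℝ ⊆ V_ℂ`. [folklore] -/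
theorem baseChange_pi_ofRealT_basis (hψ : ∀ x a, ψ x a = E x (b a)) (w : ℝ ⊗[ℚ] V) :
    ψ.baseChange ℂ (ofRealT w) =
      ∑ a, ((E.baseChange ℝ w ((1 : ℝ) ⊗ₜ[ℚ] b a) : ℝ) : ℂ) ⊗ₜ[ℚ] Pi.single a (1 : ℚ) := by
  induction w using TensorProduct.induction_on with
  | zero => simp
  | tmul r v =>
    rw [ofRealT_tmul, LinearMap.baseChange_tmul]
    conv_lhs => rw [← Finset.univ_sum_single (ψ v)]
    rw [TensorProduct.tmul_sum]
    refine Finset.sum_congr rfl fun a _ => ?_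
    rw [hψ, show (Pi.single a (E v (b a)) : κ → ℚ) = E v (b a) • Pi.single a (1 : ℚ) by
      rw [← Pi.single_smul', smul_eq_mul, mul_one], TensorProduct.tmul_smul,
      TensorProduct.smul_tmul', LinearMap.BilinForm.baseChange_tmul, mul_one, Rat.smul_def,
      Rat.smul_def, Complex.ofReal_mul, Complex.ofReal_ratCast]
  | add w w' hw hw' =>
    simp only [map_add, LinearMap.add_apply, Complex.ofReal_add, TensorProduct.add_tmul,
      Finset.sum_add_distrib, hw, hw']

omit [Module.Finite ℚ V] in
/-- `(φ_E ⊗ ℂ)(w + iw') = Σₐ (E_ℝ(w, 1 ⊗ bₐ) + iE_ℝ(w', 1 ⊗ bₐ)) ⊗ eₐ`. [folklore] -/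
theorem baseChange_pi_mkCx_basis (hψ : ∀ x a, ψ x a = E x (b a)) (w w' : ℝ ⊗[ℚ] V) :
    ψ.baseChange ℂ (mkCx w w') =
      ∑ a, (((E.baseChange ℝ w ((1 : ℝ) ⊗ₜ[ℚ] b a) : ℝ) : ℂ) +
          ((E.baseChange ℝ w' ((1 : ℝ) ⊗ₜ[ℚ] b a) : ℝ) : ℂ) * Complex.I) ⊗ₜ[ℚ]
        Pi.single a (1 : ℚ) := by
  simp only [mkCx, map_add, map_smul, baseChange_pi_ofRealT_basis b E ψ hψ, Finset.smul_sum,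
    ← Finset.sum_add_distrib]
  refine Finset.sum_congr rfl fun a _ => ?_
  rw [TensorProduct.smul_tmul', smul_eq_mul, ← TensorProduct.add_tmul, mul_comm]

/-- **`ℂ`-linear functionals on `(V_ℝ, J)` restricted to the lattice `⊕ ℤ(1 ⊗ bₐ)` come from
`cxF1 J` under `φ_E`.** For `ℓ : ℂⁿ → ℂ` `ℂ`-linear (`ℂⁿ = (V_ℝ, J)` by `coordJ`), with `w` the
`E_ℝ`-dual of `Re(ℓ ∘ coordJ)`: `(φ_E ⊗ ℂ)(w + iJw) = Σₐ ℓ(coordJ(1 ⊗ bₐ)) ⊗ eₐ`, because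
`E_ℝ(Jw, c) = -Re ℓ(coordJ(Jc)) = -Re(iℓ(coordJ c)) = Im ℓ(coordJ c)` (Voisin I §7.2.2:
"`H^{1,0}(T) = V^*` … the Hodge structure on `H¹(T)` is dual to that of" `(V, J)`; the polarisation
identifies the two). [cite: VoisinHodgeI2002, §7.2.2 (PDF p. 142)] [cite: LangeBirkenhake1992, §2.4] -/
theorem exists_mkCx_eq_sum_tmul_basis (hJ : ∀ a, J (J a) = -a) (hJ' : J * J = -1)
    (hEJ : ∀ a c, E.baseChange ℝ (J a) (J c) = E.baseChange ℝ a c)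
    (hpos : ∀ a, a ≠ 0 → 0 < E.baseChange ℝ a (J a))
    (hψ : ∀ x a, ψ x a = E x (b a)) {n : ℕ}
    (hn : Module.finrank ℝ (ℝ ⊗[ℚ] V) = 2 * n) (ℓ : (Fin n → ℂ) →L[ℂ] ℂ) :
    ∃ w : ℝ ⊗[ℚ] V, ψ.baseChange ℂ (mkCx w (J w)) =
      ∑ a, ℓ (CxModule.periodIso J hJ' hn (b.baseChange ℝ) (Pi.single a (1 : ℝ))) ⊗ₜ[ℚ]
        Pi.single a (1 : ℚ) := by
  let α : Module.Dual ℝ (ℝ ⊗[ℚ] V) :=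
    Complex.reLm ∘ₗ (ℓ.restrictScalars ℝ).toLinearMap ∘ₗ (CxModule.coordJ J hJ' hn).toLinearMap
  have hα : ∀ c, α c = (ℓ (CxModule.coordJ J hJ' hn c)).re := fun c => rfl
  let w : ℝ ⊗[ℚ] V :=
    ((E.baseChange ℝ).toDual
      (Literature.AlgebraicGeometry.HodgeTheory.nondegenerate_baseChange_real J E hJ hEJ hpos)).symm α
  have hw : ∀ c, E.baseChange ℝ w c = (ℓ (CxModule.coordJ J hJ' hn c)).re := fun c => by
    rw [← hα]
    exact LinearMap.BilinForm.apply_toDual_symm_apply α c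
  refine ⟨w, ?_⟩
  rw [baseChange_pi_mkCx_basis b E ψ hψ]
  refine Finset.sum_congr rfl fun a _ => ?_
  rw [CxModule.periodIso_single, Module.Basis.baseChange_apply,
    Literature.AlgebraicGeometry.HodgeTheory.baseChange_real_J_left J E hJ hEJ, hw, hw,
    CxModule.coordJ_J, map_smul, smul_eq_mul, Complex.I_mul_re, neg_neg, Complex.re_add_im]

end RiemannFormDualityBasis

/-! ### §B. The uniformised comparison `H¹(X(ℂ); ℚ) ↠ (V, hodgeStructureOfCx J)` for the lattice `⊕ ℤ(1 ⊗ bₐ)` -/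

/-- **The weight-one Hodge structure of the algebraic torus `(V_ℝ, J)/⊕ ℤ(1 ⊗ bₐ)` maps onto
`hodgeStructureOfCx J hJ`, for an arbitrary `ℚ`-basis `b` of `V`** (the registered stub
`stub_torusCohomologyBasis` of the line `birth`, verbatim; the Literature theorem
`weightOne_torusCohomology_of_isAnalytification` is the case `b = Module.finBasis ℚ V`). With
`T = ComplexTorus (CxModule.periodIso J hJ' hn (b.baseChange ℝ))` the polarised torus
`(V_ℝ, J)/⊕ ℤ(1 ⊗ bₐ)` and `φ : T → X(ℂ)` an analytification of a smooth projective `X` of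
dimension `n`: for the Hodge model `B` of `exists_hodgeModel_weightOne_of_complexTorus` (carrier `T`)
the `ℚ`-linear bijection `φ_E⁻¹ ∘ u : H¹(X(ℂ); ℚ) ≅ ℚ^κ ≅ V`, `φ_E(x) = (E(x, bₐ))ₐ`, is a morphism
of Hodge structures `(H¹, F_B) → hodgeStructureOfCx J hJ`: `F⁰ ↦ ⊤`, `Fᵖ = 0` for `p ≥ 2`, and on
`F¹`, `(u ⊗ ℂ)x = Σ ℓ(Φeₐ) ⊗ eₐ` equals `(φ_E ⊗ ℂ)(w + iJw)` (`exists_mkCx_eq_sum_tmul_basis`), and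
`w + iJw ∈ cxF1 J = F¹` (Voisin I §7.2.2: "the Hodge structure on `H¹(T)` is dual to" the given
one, the polarisation identifying the two; Lange–Birkenhake Lemma 1.1.17, Thm. 1.1.21, §2.4).
[cite: VoisinHodgeI2002, §7.2.2 (PDF p. 142)]
[cite: LangeBirkenhake1992, §1.1 Lemma 1.1.17 and Thm. 1.1.21] -/
theorem stub_torusCohomologyBasis :
    ∀ ⦃V : Type⦄ [AddCommGroup V] [Module ℚ V] [Module.Finite ℚ V] ⦃κ : Type⦄ [Fintype κ]
      (b : Module.Basis κ ℚ V)
      (J : ℝ ⊗[ℚ] V →ₗ[ℝ] ℝ ⊗[ℚ] V) (hJ : ∀ a, J (J a) = -a) (hJ' : J * J = -1)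
      (E : LinearMap.BilinForm ℚ V),
      (∀ x y, E y x = -E x y) → (∀ a c, E.baseChange ℝ (J a) (J c) = E.baseChange ℝ a c) →
      (∀ a, a ≠ 0 → 0 < E.baseChange ℝ a (J a)) →
      ∀ ⦃n : ℕ⦄ (hn : Module.finrank ℝ (ℝ ⊗[ℚ] V) = 2 * n) (X : SchemeOver ℂ)
        (hX : IsSmoothProjective n X)
        (φ : ComplexTorus (CxModule.periodIso J hJ' hn (b.baseChange ℝ)) → ComplexPoints X),
        IsAnalytification (Fin n → ℂ) X n φ →
        ∃ (B : HodgeModel n X) (hB : B.IsHodgeSymmetric)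
          (f : HodgeStructure.Hom ((B.hodgeStructure hX hB 1).cast Nat.cast_one)
            (HodgeStructure.hodgeStructureOfCx J hJ)),
          Function.Surjective f.toLinearMap := by
  intro V _ _ _ κ _ b J hJ hJ' E _hE hEJ hpos n hn X hX φ hφ
  classical
  obtain ⟨B, hB, u, hu⟩ :=
    Literature.AlgebraicGeometry.HodgeTheory.exists_hodgeModel_weightOne_of_complexTorus
      (CxModule.periodIso J hJ' hn (b.baseChange ℝ)) hX φ hφ
  -- `φ_E : V ≅ ℚ^κ`
  let ψ : V →ₗ[ℚ] (κ → ℚ) := LinearMap.pi fun a => E.flip (b a)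
  have hψ : ∀ x a, ψ x a = E x (b a) := fun x a => rfl
  let ψe : V ≃ₗ[ℚ] (κ → ℚ) :=
    LinearEquiv.ofBijective ψ (bijective_of_riemannForm_basis b J E ψ hpos hψ)
  have hψe : ψe.symm.toLinearMap ∘ₗ ψ = LinearMap.id :=
    LinearMap.ext fun y => ψe.symm_apply_apply y
  refine ⟨B, hB, ⟨ψe.symm.toLinearMap ∘ₗ u.toLinearMap, fun p => ?_⟩,
    ψe.symm.surjective.comp u.surjective⟩
  rcases le_or_gt p 0 with hp | hp
  · rw [hodgeStructureOfCx_F, twoStepFiltration_of_le_zero _ hp]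
    exact le_top
  rcases eq_or_lt_of_le (show (1 : ℤ) ≤ p by omega) with hp1 | hp1
  · subst hp1
    rw [cast_F, hodgeStructureOfCx_F_one]
    rintro _ ⟨x, hx, rfl⟩
    obtain ⟨ℓ, hℓ⟩ := hu x hx
    obtain ⟨w, hw⟩ := exists_mkCx_eq_sum_tmul_basis b J E ψ hJ hJ' hEJ hpos hψ hn ℓ
    have h1 : ((ψe.symm.toLinearMap ∘ₗ u.toLinearMap).baseChange ℂ) x = mkCx w (J w) := by
      rw [LinearMap.baseChange_comp, LinearMap.comp_apply, hℓ, ← hw, ← LinearMap.comp_apply,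
        ← LinearMap.baseChange_comp, hψe, LinearMap.baseChange_id, LinearMap.id_apply]
    show ((ψe.symm.toLinearMap ∘ₗ u.toLinearMap).baseChange ℂ) x ∈ cxF1 J
    rw [h1]
    exact mkCx_mem_cxF1 J hJ w
  · rw [cast_F, Literature.AlgebraicGeometry.HodgeTheory.HodgeModel.hodgeStructure_one_F_eq_bot B
      hX hB (show 2 ≤ p by omega), Submodule.map_bot]
    exact bot_le

end Summit.HodgeConjecture.HodgeConjecture.Theorems.RiemannWeightOne

end
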